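import Mathlib
import HarnessLib
import Summits.HubbardSuperconductivity.HubbardSuperconductivity.Theorems.KLProgrammeKLRegimeWickCrossContractionSized

/-!
# Route `KLProgramme` — ENGINE child (stmt-HubbardSuperconductivity-19918), `stub_engine_step_values` (E2-v9), E2-WICK-ROADMAP §5 (iv):
# the `k + 1`-line two-vertex term — VALUE form (every output leg fixed), reaching the TOP sector levels

Cell gate-hubbard-kl, seat p5 (g4).  Companion of …WickCrossContractionSum/…Sized (there: ONE output leg pinned, the other output legs summed = the
`L¹–L^∞` NORM of the output).  The (E2) value lane consumes ENTRYWISE majorants (k3c1-p1 g6: `∫|X(t)(x,y)|`), i.e. the output kernel at a FIXED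
labelled tuple `(Z, s)`.  Then no output leg is summed, each vertex is read with ALL ITS FREE LEGS FIXED, and FKT's device (line `0` in `L¹`,
lines `i ≥ 1` sup × sector-diagonal) reads `a` with its free legs fixed and its `k + 1` contracted legs summed, `b` with its line-`0` leg, the SECTORS of
its other `k` contracted legs AND all its free legs fixed — for sector preimages these are sectorised norms at level `m₀` resp. `k + 1 + m₁` (ALL legs of
`b`), the top of BGM's (2.98) ladder (`levelGainExp = 2`, gain `4^{-n}`, as soon as `k + 1 + m₁ ≥ 5`):

* `sum_crossContraction_value_le` / `…_symm` — the pure-sum device without output sums;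
* **`norm_kernel_crossContract_value_le`** / `…_of_b` — generic lines `c, d_i, D_i, r_i`:
  `‖kernel ((Δ_×(C_k)∘⋯∘Δ_×(C_0))(a⁰·b¹)) m (Z,s)‖ ≤ ((k+1+m₀)!(k+1+m₁)!/m!)·(c·∏_i(d_i r_i)·Na·Nb)`;
* **`norm_kernel_crossContract_value_pullback_le`** — lines `S(F)ᵀ·C_{p_i}·S(F)`, overlap automatic (`ρ = 4ρ₀`);
* `sum_append_fixed_eq_sum_filter`, `sum_cons_append_fixed_eq_sum_filter`, `levelCount_append_none_some`, `levelCount_all_some`,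
  **`sum_fixed_norm_kernel_sectorPreimage_le`** (`a`: `≤ ε_x‖G‖` at level `m₀+1`… see the statement) and
  **`sum_levels_fixed_norm_kernel_sectorPreimage_le`** (`b`: `≤ ε_x‖G‖` at level `k+1+m₁`, all legs prescribed);
* **`norm_kernel_crossContract_value_sectorPreimage_le`** — the assembled VALUE statement in engine currency.

Pure bookkeeping; no definitions, no named facts.  References (locators only): Feldman–Knörrer–Trubowitz, Rev. Math. Phys. 15 (2003) Prop. XII;
Benfatto–Giuliani–Mastropietro, Ann. Henri Poincaré 7 (2006) §2.8 (2.76), Lemma 2.5 (2.98).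
-/

noncomputable section

namespace Summit.HubbardSuperconductivity.HubbardSuperconductivity.Theorems.KLRegimeWick

set_option linter.dupNamespace false -- summit = problem name (single-conjunct summit), D-0017

open Literature.MathematicalPhysics.QuantumLattice Literature.Probability.LatticeModels GrassmannAlgebra Finset Matrix
open Summit.HubbardSuperconductivity.HubbardSuperconductivity.Theorems.KLRegimeSplit

/-! ## §1 The pure-sum device without output sums -/

section Pure

variable {P S : Type*} [Fintype P] [Fintype S] [DecidableEq P] [DecidableEq S]

omit [DecidableEq P] [DecidableEq S] in
/-- Sums over `k + 1`-tuples split into head and tail (`Fin.consEquiv`). -/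
private theorem sum_pi_succ_eq_sum_sum_cons' {α : Type*} [Fintype α] {A : Type*} [AddCommMonoid A] {k : ℕ}
    (f : (Fin (k + 1) → α) → A) : ∑ Y : Fin (k + 1) → α, f Y = ∑ y₀ : α, ∑ Yr : Fin k → α, f (Fin.cons y₀ Yr) := by
  rw [← Fintype.sum_prod_type']
  exact (Fintype.sum_equiv (Fin.consEquiv fun _ => α) _ _ fun q => rfl).symm

omit [DecidableEq P] [DecidableEq S] in
/-- **The `k + 1`-line contraction of two size functions, no output sums** (FKT Prop. XII device, value form): line `0` by its ROW sums
(`≤ c`), lines `i ≥ 1` sup × sector-diagonal; `a` summed over its `k + 1` contracted legs (`≤ Na`); `b` summed over the POSITIONS of its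
contracted legs `1 … k` with its line-`0` leg and the sectors of the others fixed (`≤ Nb`):
`Σ_{X,Y} (∏_i L_i(X_i,Y_i))·Ka(X)·Kb(Y) ≤ c·(∏_i d_i r_i)·Na·Nb`. -/
theorem sum_crossContraction_value_le {k : ℕ} (Ka Kb : (Fin (k + 1) → P × S) → ℝ) (hKa : ∀ X, 0 ≤ Ka X) (hKb : ∀ Y, 0 ≤ Kb Y)
    (L : Fin (k + 1) → (P × S) → (P × S) → ℝ) (hL : ∀ i X Y, 0 ≤ L i X Y) {c : ℝ} (hc0 : 0 ≤ c) (hc : ∀ X, ∑ Y, L 0 X Y ≤ c)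
    (D : Fin k → S → S → ℝ) (hD : ∀ i σ τ, 0 ≤ D i σ τ) (d r : Fin k → ℝ) (hd : ∀ i, 0 ≤ d i) (hr0 : ∀ i, 0 ≤ r i)
    (hLD : ∀ (i : Fin k) (X Y : P × S), L i.succ X Y ≤ d i * D i X.2 Y.2) (hr : ∀ i σ, ∑ τ, D i σ τ ≤ r i)
    {Na Nb : ℝ} (hNb0 : 0 ≤ Nb) (hNa : ∑ X, Ka X ≤ Na)
    (hNb : ∀ (Y₀ : P × S) (τ : Fin k → S), ∑ y : Fin k → P, Kb (Fin.cons Y₀ (fun i => (y i, τ i))) ≤ Nb) :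
    ∑ X : Fin (k + 1) → P × S, ∑ Y : Fin (k + 1) → P × S, (∏ i, L i (X i) (Y i)) * Ka X * Kb Y ≤ c * (∏ i, d i * r i) * Na * Nb := by
  have hdr0 : 0 ≤ ∏ i, d i * r i := prod_nonneg fun i _ => mul_nonneg (hd i) (hr0 i)
  have hinner : ∀ X : Fin (k + 1) → P × S,
      ∑ Y : Fin (k + 1) → P × S, (∏ i, L i (X i) (Y i)) * Kb Y ≤ c * (∏ i, d i * r i) * Nb := by
    intro X
    rw [sum_pi_succ_eq_sum_sum_cons']
    have hsplit : ∀ (y₀ : P × S) (Yr : Fin k → P × S),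
        (∏ i, L i (X i) ((Fin.cons y₀ Yr : Fin (k + 1) → P × S) i)) = L 0 (X 0) y₀ * ∏ i : Fin k, L i.succ (X i.succ) (Yr i) := by
      intro y₀ Yr
      rw [Fin.prod_univ_succ]
      simp only [Fin.cons_zero, Fin.cons_succ]
    simp_rw [hsplit]
    calc ∑ y₀ : P × S, ∑ Yr : Fin k → P × S, L 0 (X 0) y₀ * (∏ i : Fin k, L i.succ (X i.succ) (Yr i)) * Kb (Fin.cons y₀ Yr)
        = ∑ y₀ : P × S, L 0 (X 0) y₀ * ∑ Yr : Fin k → P × S, (∏ i : Fin k, L i.succ (X i.succ) (Yr i)) * Kb (Fin.cons y₀ Yr) := by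
          refine sum_congr rfl fun y₀ _ => ?_
          rw [mul_sum]
          exact sum_congr rfl fun Yr _ => by ring
      _ ≤ ∑ y₀ : P × S, L 0 (X 0) y₀ * ((∏ i, d i * r i) * Nb) := by
          refine sum_le_sum fun y₀ _ => mul_le_mul_of_nonneg_left ?_ (hL 0 _ _)
          exact sum_prod_line_mul_le (fun i => L i.succ) (fun i => hL i.succ) D hD d r hd hLD hr (fun i => X i.succ)
            (fun Yr => Kb (Fin.cons y₀ Yr)) (fun Yr => hKb _) hNb0 (fun τ => hNb y₀ τ)
      _ = (∑ y₀ : P × S, L 0 (X 0) y₀) * ((∏ i, d i * r i) * Nb) := by rw [sum_mul]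
      _ ≤ c * ((∏ i, d i * r i) * Nb) := mul_le_mul_of_nonneg_right (hc (X 0)) (mul_nonneg hdr0 hNb0)
      _ = c * (∏ i, d i * r i) * Nb := by ring
  calc ∑ X : Fin (k + 1) → P × S, ∑ Y : Fin (k + 1) → P × S, (∏ i, L i (X i) (Y i)) * Ka X * Kb Y
      = ∑ X : Fin (k + 1) → P × S, Ka X * ∑ Y : Fin (k + 1) → P × S, (∏ i, L i (X i) (Y i)) * Kb Y := by
        refine sum_congr rfl fun X _ => ?_
        rw [mul_sum]
        exact sum_congr rfl fun Y _ => by ring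
    _ ≤ ∑ X : Fin (k + 1) → P × S, Ka X * (c * (∏ i, d i * r i) * Nb) :=
        sum_le_sum fun X _ => mul_le_mul_of_nonneg_left (hinner X) (hKa X)
    _ = (∑ X : Fin (k + 1) → P × S, Ka X) * (c * (∏ i, d i * r i) * Nb) := by rw [sum_mul]
    _ ≤ Na * (c * (∏ i, d i * r i) * Nb) := mul_le_mul_of_nonneg_right hNa (mul_nonneg (mul_nonneg hc0 hdr0) hNb0)
    _ = c * (∏ i, d i * r i) * Na * Nb := by ring

omit [DecidableEq P] [DecidableEq S] in
/-- **The same with the roles exchanged**: line `0` by its COLUMN sums, `a` summed over the positions of its contracted legs `1 … k` with its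
line-`0` leg and the sectors of the others fixed (`≤ Na`), `b` summed over its `k + 1` contracted legs (`≤ Nb`). -/
theorem sum_crossContraction_value_le_symm {k : ℕ} (Ka Kb : (Fin (k + 1) → P × S) → ℝ) (hKa : ∀ X, 0 ≤ Ka X) (hKb : ∀ Y, 0 ≤ Kb Y)
    (L : Fin (k + 1) → (P × S) → (P × S) → ℝ) (hL : ∀ i X Y, 0 ≤ L i X Y) {c : ℝ} (hc0 : 0 ≤ c) (hc : ∀ Y, ∑ X, L 0 X Y ≤ c)
    (D : Fin k → S → S → ℝ) (hD : ∀ i σ τ, 0 ≤ D i σ τ) (d r : Fin k → ℝ) (hd : ∀ i, 0 ≤ d i) (hr0 : ∀ i, 0 ≤ r i)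
    (hLD : ∀ (i : Fin k) (X Y : P × S), L i.succ X Y ≤ d i * D i X.2 Y.2) (hr : ∀ i τ, ∑ σ, D i σ τ ≤ r i)
    {Na Nb : ℝ} (hNa0 : 0 ≤ Na)
    (hNa : ∀ (X₀ : P × S) (σ : Fin k → S), ∑ x : Fin k → P, Ka (Fin.cons X₀ (fun i => (x i, σ i))) ≤ Na) (hNb : ∑ Y, Kb Y ≤ Nb) :
    ∑ X : Fin (k + 1) → P × S, ∑ Y : Fin (k + 1) → P × S, (∏ i, L i (X i) (Y i)) * Ka X * Kb Y ≤ c * (∏ i, d i * r i) * Na * Nb := by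
  have h := sum_crossContraction_value_le Kb Ka hKb hKa (fun i X Y => L i Y X) (fun i X Y => hL i Y X) hc0 hc
    (fun i σ τ => D i τ σ) (fun i σ τ => hD i τ σ) d r hd hr0 (fun i X Y => hLD i Y X) hr hNa0 hNb hNa
  calc ∑ X : Fin (k + 1) → P × S, ∑ Y : Fin (k + 1) → P × S, (∏ i, L i (X i) (Y i)) * Ka X * Kb Y
      = ∑ Y : Fin (k + 1) → P × S, ∑ X : Fin (k + 1) → P × S, (∏ i, L i (X i) (Y i)) * Kb Y * Ka X := by
        rw [sum_comm]
        exact sum_congr rfl fun Y _ => sum_congr rfl fun X _ => by ring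
    _ ≤ c * (∏ i, d i * r i) * Nb * Na := h
    _ = c * (∏ i, d i * r i) * Na * Nb := by ring

end Pure

/-! ## §2 The Grassmann value form, generic lines -/

section Value

variable {𝕜 : Type*} [RCLike 𝕜] {P S : Type*} [Fintype P] [Fintype S] [DecidableEq P] [DecidableEq S]

/-- **Value form of the `k + 1`-line two-vertex term** (every output leg fixed): for a colouring `s` with `m₀` legs from `a` and `m₁` from `b` and
ANY labelled output tuple `Z`,
`‖kernel ((Δ_×(C_k)∘⋯∘Δ_×(C_0))(a⁰·b¹)) m (Z,s)‖ ≤ ((k+1+m₀)!(k+1+m₁)!/m!)·(c·∏_i(d_i r_i)·Na·Nb)`,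
where `Na` bounds `a` with its free legs fixed (anywhere) and its contracted legs summed, `Nb` bounds `b` with its line-`0` leg, the sectors of its
other contracted legs and its free legs fixed (positions of the contracted legs `1 … k` summed). -/
theorem norm_kernel_crossContract_value_le {k m m₀ m₁ : ℕ} (C : Fin (k + 1) → Matrix (P × S) (P × S) 𝕜)
    (a b : GrassmannAlgebra 𝕜 (P × S)) (s : Fin m → Fin 2) (hm₀ : (univ.filter fun i => s i = 0).card = m₀)
    (hm₁ : (univ.filter fun i => s i = 1).card = m₁) (Z : Fin m → P × S)
    {c : ℝ} (hc0 : 0 ≤ c) (hc : ∀ X, ∑ Y, ‖contr 𝕜 (C 0) X Y‖ ≤ c)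
    (D : Fin k → S → S → ℝ) (hD : ∀ i σ τ, 0 ≤ D i σ τ) (d r : Fin k → ℝ) (hd : ∀ i, 0 ≤ d i) (hr0 : ∀ i, 0 ≤ r i)
    (hLD : ∀ (i : Fin k) (X Y : P × S), ‖contr 𝕜 (C i.succ) X Y‖ ≤ d i * D i X.2 Y.2) (hr : ∀ i σ, ∑ τ, D i σ τ ≤ r i)
    {Na Nb : ℝ} (hNb0 : 0 ≤ Nb)
    (hNa : ∀ X₀ : Fin m₀ → P × S, ∑ X : Fin (k + 1) → P × S, ‖kernel 𝕜 a (k + 1 + m₀) (Fin.append X X₀)‖ ≤ Na)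
    (hNb : ∀ (Y₀ : P × S) (τ : Fin k → S) (Y₁ : Fin m₁ → P × S), ∑ y : Fin k → P,
      ‖kernel 𝕜 b (k + 1 + m₁) (Fin.append (Fin.cons Y₀ (fun i => (y i, τ i)) : Fin (k + 1) → P × S) Y₁)‖ ≤ Nb) :
    ‖kernel 𝕜 (((List.ofFn fun i => grassmannLaplacian 𝕜 (crossCov 𝕜 (C i))).reverse).prod
        (dblCopy 𝕜 0 a * dblCopy 𝕜 1 b)) m (fun i => (Z i, s i))‖ ≤
      (((k + 1 + m₀).factorial * (k + 1 + m₁).factorial : ℝ) / m.factorial) * (c * (∏ i, d i * r i) * Na * Nb) := by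
  classical
  obtain ⟨h, σ, ε, h0, h1, hZ⟩ := exists_colouring_equiv (Γ := P × S) s hm₀ hm₁
  refine (norm_kernel_crossContract_le C a b (fun i => (Z i, s i)) h σ (fun j => Z (ε (Sum.inl j))) (fun j => Z (ε (Sum.inr j)))
    (hZ Z)).trans ?_
  refine mul_le_mul_of_nonneg_left ?_ (by positivity)
  have hmain := sum_crossContraction_value_le
    (fun X => ‖kernel 𝕜 a (k + 1 + m₀) (Fin.append X fun j => Z (ε (Sum.inl j)))‖)
    (fun Y => ‖kernel 𝕜 b (k + 1 + m₁) (Fin.append Y fun j => Z (ε (Sum.inr j)))‖) (fun X => norm_nonneg _) (fun Y => norm_nonneg _)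
    (fun i X Y => ‖contr 𝕜 (C i) X Y‖) (fun i X Y => norm_nonneg _) hc0 hc D hD d r hd hr0 hLD hr hNb0 (hNa _)
    (fun Y₀ τ => hNb Y₀ τ _)
  refine le_trans (le_of_eq ?_) hmain
  exact sum_congr rfl fun X _ => sum_congr rfl fun Y _ => by ring

/-- **Value form, roles exchanged** (`a` read with its line-`0` leg, the sectors of its other contracted legs and its free legs fixed; `b` with
its free legs fixed and its contracted legs summed; line `0` again by row sums of its two-point function — they equal its column sums). -/
theorem norm_kernel_crossContract_value_le_of_b {k m m₀ m₁ : ℕ} (C : Fin (k + 1) → Matrix (P × S) (P × S) 𝕜)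
    (a b : GrassmannAlgebra 𝕜 (P × S)) (s : Fin m → Fin 2) (hm₀ : (univ.filter fun i => s i = 0).card = m₀)
    (hm₁ : (univ.filter fun i => s i = 1).card = m₁) (Z : Fin m → P × S)
    {c : ℝ} (hc0 : 0 ≤ c) (hc : ∀ X, ∑ Y, ‖contr 𝕜 (C 0) X Y‖ ≤ c)
    (D : Fin k → S → S → ℝ) (hD : ∀ i σ τ, 0 ≤ D i σ τ) (d r : Fin k → ℝ) (hd : ∀ i, 0 ≤ d i) (hr0 : ∀ i, 0 ≤ r i)
    (hLD : ∀ (i : Fin k) (X Y : P × S), ‖contr 𝕜 (C i.succ) X Y‖ ≤ d i * D i X.2 Y.2) (hr : ∀ i τ, ∑ σ, D i σ τ ≤ r i)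
    {Na Nb : ℝ} (hNa0 : 0 ≤ Na)
    (hNa : ∀ (X₀ : P × S) (σ : Fin k → S) (Z₀ : Fin m₀ → P × S), ∑ x : Fin k → P,
      ‖kernel 𝕜 a (k + 1 + m₀) (Fin.append (Fin.cons X₀ (fun i => (x i, σ i)) : Fin (k + 1) → P × S) Z₀)‖ ≤ Na)
    (hNb : ∀ Y₁ : Fin m₁ → P × S, ∑ Y : Fin (k + 1) → P × S, ‖kernel 𝕜 b (k + 1 + m₁) (Fin.append Y Y₁)‖ ≤ Nb) :
    ‖kernel 𝕜 (((List.ofFn fun i => grassmannLaplacian 𝕜 (crossCov 𝕜 (C i))).reverse).prod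
        (dblCopy 𝕜 0 a * dblCopy 𝕜 1 b)) m (fun i => (Z i, s i))‖ ≤
      (((k + 1 + m₀).factorial * (k + 1 + m₁).factorial : ℝ) / m.factorial) * (c * (∏ i, d i * r i) * Na * Nb) := by
  classical
  obtain ⟨h, σ, ε, h0, h1, hZ⟩ := exists_colouring_equiv (Γ := P × S) s hm₀ hm₁
  refine (norm_kernel_crossContract_le C a b (fun i => (Z i, s i)) h σ (fun j => Z (ε (Sum.inl j))) (fun j => Z (ε (Sum.inr j)))
    (hZ Z)).trans ?_
  refine mul_le_mul_of_nonneg_left ?_ (by positivity)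
  have hc' : ∀ Y, ∑ X, ‖contr 𝕜 (C 0) X Y‖ ≤ c := fun Y => by
    simp_rw [norm_contr_swap (C 0) Y]; exact hc Y
  have hmain := sum_crossContraction_value_le_symm
    (fun X => ‖kernel 𝕜 a (k + 1 + m₀) (Fin.append X fun j => Z (ε (Sum.inl j)))‖)
    (fun Y => ‖kernel 𝕜 b (k + 1 + m₁) (Fin.append Y fun j => Z (ε (Sum.inr j)))‖) (fun X => norm_nonneg _) (fun Y => norm_nonneg _)
    (fun i X Y => ‖contr 𝕜 (C i) X Y‖) (fun i X Y => norm_nonneg _) hc0 hc' D hD d r hd hr0 hLD hr hNa0 (fun X₀ σ' => hNa X₀ σ' _)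
    (hNb _)
  refine le_trans (le_of_eq ?_) hmain
  exact sum_congr rfl fun X _ => sum_congr rfl fun Y _ => by ring

end Value

/-! ## §3 Lines `S(F)ᵀ·C_p·S(F)`: overlap automatic -/

section Pullback

variable {L M N : ℕ} [NeZero L]

/-- **Value form for sectorised normal covariances** (one family `F` with at most `ρ₀` overlap partners, symbols `p_0, …, p_k`; line `0`:
row/column sums `≤ α`, lines `i ≥ 1`: entries `≤ δ_i`): for every colouring and every labelled output tuple,
`‖kernel (…) m (Z,s)‖ ≤ ((k+1+m₀)!(k+1+m₁)!/m!)·(α·∏_i(δ_i·4ρ₀)·Na·Nb)` with `Na`, `Nb` as in `norm_kernel_crossContract_value_le`. -/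
theorem norm_kernel_crossContract_value_pullback_le {k m m₀ m₁ : ℕ} (β : ℝ) (F : Fin N → FreqMomentum L M → ℂ) {ρ₀ : ℕ}
    (hρ₀ : ∀ ω : Fin N, ((univ : Finset (Fin N)).filter fun ω' => ∃ q, F ω q * F ω' q ≠ 0).card ≤ ρ₀)
    (sym : Fin (k + 1) → FreqMomentum L M × Fin 2 → ℂ)
    (a b : GrassmannAlgebra ℂ (SpaceTimeIdx L M × SectorLeg N)) (s : Fin m → Fin 2)
    (hm₀ : (univ.filter fun i => s i = 0).card = m₀) (hm₁ : (univ.filter fun i => s i = 1).card = m₁)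
    (Z : Fin m → SpaceTimeIdx L M × SectorLeg N) {α : ℝ} (hα : 0 ≤ α)
    (hrow : ∀ X, ∑ Y, ‖((sectorSubMatrix L M β F).transpose * normalCovariance L M (sym 0) * sectorSubMatrix L M β F) X Y‖ ≤ α)
    (hcol : ∀ Y, ∑ X, ‖((sectorSubMatrix L M β F).transpose * normalCovariance L M (sym 0) * sectorSubMatrix L M β F) X Y‖ ≤ α)
    (δ : Fin k → ℝ) (hδ : ∀ i, 0 ≤ δ i)
    (hent : ∀ (i : Fin k) X Y,
      ‖((sectorSubMatrix L M β F).transpose * normalCovariance L M (sym i.succ) * sectorSubMatrix L M β F) X Y‖ ≤ δ i)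
    {Na Nb : ℝ} (hNb0 : 0 ≤ Nb)
    (hNa : ∀ X₀ : Fin m₀ → SpaceTimeIdx L M × SectorLeg N, ∑ X : Fin (k + 1) → SpaceTimeIdx L M × SectorLeg N,
      ‖kernel ℂ a (k + 1 + m₀) (Fin.append X X₀)‖ ≤ Na)
    (hNb : ∀ (Y₀ : SpaceTimeIdx L M × SectorLeg N) (τ : Fin k → SectorLeg N) (Y₁ : Fin m₁ → SpaceTimeIdx L M × SectorLeg N),
      ∑ y : Fin k → SpaceTimeIdx L M,
        ‖kernel ℂ b (k + 1 + m₁) (Fin.append (Fin.cons Y₀ (fun i => (y i, τ i)) : Fin (k + 1) → SpaceTimeIdx L M × SectorLeg N) Y₁)‖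
          ≤ Nb) :
    ‖kernel ℂ (((List.ofFn fun i => grassmannLaplacian ℂ (crossCov ℂ
        ((sectorSubMatrix L M β F).transpose * normalCovariance L M (sym i) * sectorSubMatrix L M β F))).reverse).prod
        (dblCopy ℂ 0 a * dblCopy ℂ 1 b)) m (fun i => (Z i, s i))‖ ≤
      (((k + 1 + m₀).factorial * (k + 1 + m₁).factorial : ℝ) / m.factorial) * (α * (∏ i, δ i * ((4 * ρ₀ : ℕ) : ℝ)) * Na * Nb) := by
  classical
  refine norm_kernel_crossContract_value_le
    (fun i => (sectorSubMatrix L M β F).transpose * normalCovariance L M (sym i) * sectorSubMatrix L M β F) a b s hm₀ hm₁ Z hα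
    (sum_norm_contr_le _ hrow hcol) (fun _ σ τ => if (∃ q, F σ.1.1 q * F τ.1.1 q ≠ 0) then (1 : ℝ) else 0) (fun _ σ τ => by positivity)
    δ (fun _ => ((4 * ρ₀ : ℕ) : ℝ)) hδ (fun _ => by positivity)
    (fun i X Y => norm_contr_le_indicator_of_support _ (fun σ τ : SectorLeg N => ∃ q, F σ.1.1 q * F τ.1.1 q ≠ 0)
      (fun σ τ ⟨q, hq⟩ => ⟨q, by rwa [mul_comm] at hq⟩) (hδ i) (hent i)
      (fun X Y hXY => exists_mul_ne_zero_of_pullback_normalCovariance_ne_zero β F (sym i.succ) hXY) X Y)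
    (fun _ σ => sum_indicator_le_of_card_le (fun σ τ : SectorLeg N => ∃ q, F σ.1.1 q * F τ.1.1 q ≠ 0) (fun σ' => ?_) σ) hNb0 hNa hNb
  exact (card_filter_sectorLeg_le fun ω' => ∃ q, F σ'.1.1 q * F ω' q ≠ 0).trans (Nat.mul_le_mul_left 4 (hρ₀ σ'.1.1))

end Pullback

/-! ## §4 The vertex sizes of the sector preimage with free legs FIXED: sectorised norms at the top levels -/

section FixedSizes

variable {α : Type*} [Fintype α] [DecidableEq α] {A : Type*} [AddCommMonoid A]

/-- `Σ_X f (append X X₀) = Σ_{Y : second block = X₀} f Y`. -/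
theorem sum_append_fixed_eq_sum_filter {n₁ n₂ : ℕ} (f : (Fin (n₁ + n₂) → α) → A) (X₀ : Fin n₂ → α) :
    ∑ X : Fin n₁ → α, f (Fin.append X X₀) =
      ∑ Y ∈ univ.filter (fun Y : Fin (n₁ + n₂) → α => ∀ j, Y (Fin.natAdd n₁ j) = X₀ j), f Y := by
  rw [sum_filter, ← sum_sum_append_eq]
  refine sum_congr rfl fun X _ => ?_
  simp_rw [Fin.append_right]
  rw [Finset.sum_eq_single_of_mem X₀ (mem_univ _) fun X₀' _ hne => ?_]
  · rw [if_pos fun _ => rfl]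
  · rw [if_neg fun h => hne (funext h)]

/-- `Σ_y f (append (cons Y₀ (y,τ)) Y₁) = Σ_{Y : Y(0) = Y₀, sectors of legs 1…k = τ, second block = Y₁} f Y`. -/
theorem sum_cons_append_fixed_eq_sum_filter {P S : Type*} [Fintype P] [Fintype S] [DecidableEq P] [DecidableEq S] {k m₁ : ℕ}
    (f : (Fin (k + 1 + m₁) → P × S) → A) (Y₀ : P × S) (τ : Fin k → S) (Y₁ : Fin m₁ → P × S) :
    ∑ y : Fin k → P, f (Fin.append (Fin.cons Y₀ (fun i => (y i, τ i)) : Fin (k + 1) → P × S) Y₁) =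
      ∑ Y ∈ univ.filter (fun Y : Fin (k + 1 + m₁) → P × S =>
        (Y (Fin.castAdd m₁ 0) = Y₀ ∧ ∀ i : Fin k, (Y (Fin.castAdd m₁ i.succ)).2 = τ i) ∧ ∀ j, Y (Fin.natAdd (k + 1) j) = Y₁ j), f Y := by
  classical
  have h := sum_sum_append_cons_eq_sum_filter
    (fun Y : Fin (k + 1 + m₁) → P × S => if (∀ j, Y (Fin.natAdd (k + 1) j) = Y₁ j) then f Y else 0) Y₀ τ
  simp_rw [Fin.append_right] at h
  rw [← filter_filter, sum_filter (fun Y : Fin (k + 1 + m₁) → P × S => ∀ j, Y (Fin.natAdd (k + 1) j) = Y₁ j), ← h]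
  refine sum_congr rfl fun y _ => ?_
  rw [Finset.sum_eq_single_of_mem Y₁ (mem_univ _) fun Y₁' _ hne => ?_]
  · rw [if_pos fun _ => rfl]
  · rw [if_neg fun h' => hne (funext h')]

variable {N : ℕ}

/-- The level of «first block free, second block prescribed»: `levelCount = n₂`. -/
theorem levelCount_append_none_some {n₁ n₂ : ℕ} (σ₀ : Fin n₂ → SectorLeg N) :
    levelCount (Fin.append (fun _ : Fin n₁ => (none : Option (SectorLeg N))) (fun j => some (σ₀ j))) = n₂ := by
  rw [levelCount]
  have hset : (univ.filter fun i : Fin (n₁ + n₂) =>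
      (Fin.append (fun _ : Fin n₁ => (none : Option (SectorLeg N))) (fun j => some (σ₀ j)) i).isSome) =
      (univ : Finset (Fin n₂)).map ⟨Fin.natAdd n₁, fun i j hij => by simpa [Fin.ext_iff] using hij⟩ := by
    ext j
    simp only [mem_filter, mem_univ, true_and, mem_map, Function.Embedding.coeFn_mk]
    constructor
    · intro hj
      induction j using Fin.addCases with
      | left j' => simp at hj
      | right j' => exact ⟨j', rfl⟩
    · rintro ⟨i, rfl⟩
      simp
  rw [hset, card_map, card_univ, Fintype.card_fin]

/-- The level of «every leg prescribed»: `levelCount = m`. -/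
theorem levelCount_all_some {m : ℕ} (Ω : Fin m → SectorLeg N) : levelCount (fun i => some (Ω i)) = m := by
  rw [levelCount]
  simp

variable {L M : ℕ} [NeZero L]

/-- **`Na` of the value form is a sectorised norm at level `m₀ + 1`** (the free legs' sectors prescribed; `a` anchored at its first free leg):
`Σ_X ‖kernel (sectorPreimage β F G) (n₁ + (m₀+1)) (append X X₀)‖ ≤ ε_x·‖G‖_{prescribedTuples univ (append none (some ∘ snd ∘ X₀))}`. -/
theorem sum_fixed_norm_kernel_sectorPreimage_le {β : ℝ} (hβ : 0 ≤ β) (F : Fin N → FreqMomentum L M → ℂ) (G : HubbardGrassmann L M)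
    {n₁ m₀ : ℕ} (X₀ : Fin (m₀ + 1) → SpaceTimeIdx L M × SectorLeg N) :
    ∑ X : Fin n₁ → SpaceTimeIdx L M × SectorLeg N, ‖kernel ℂ (sectorPreimage β F G) (n₁ + (m₀ + 1)) (Fin.append X X₀)‖ ≤
      imagTimeWeight β M * hubbardSectorKernelNorm L M β F (prescribedTuples univ
        (Fin.append (fun _ : Fin n₁ => (none : Option (SectorLeg N))) (fun j => some (X₀ j).2))) G := by
  classical
  rw [sum_append_fixed_eq_sum_filter (fun Y => ‖kernel ℂ (sectorPreimage β F G) (n₁ + (m₀ + 1)) Y‖) X₀]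
  refine le_trans (sum_le_sum_of_subset_of_nonneg (fun Y hY => ?_) fun Y _ _ => norm_nonneg _)
    (sum_filter_prescribed_norm_kernel_sectorPreimage_le hβ F G (Fin.natAdd n₁ 0) (X₀ 0) _)
  rw [mem_filter] at hY ⊢
  obtain ⟨-, hY⟩ := hY
  refine ⟨mem_univ _, hY 0, fun i => Fin.addCases (fun i' => ?_) (fun j => ?_) i⟩
  · intro t ht
    simp only [Fin.append_left, Option.mem_def] at ht
    exact absurd ht (by simp)
  · intro t ht
    simp only [Fin.append_right, Option.mem_def, Option.some.injEq] at ht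
    rw [← ht, hY j]

/-- **`Nb` of the value form is a sectorised norm with EVERY leg prescribed** (level `k + 1 + m₁`; `b` anchored at its line-`0` leg):
`Σ_y ‖kernel (sectorPreimage β F G) (k+1+m₁) (append (cons Y₀ (y,τ)) Y₁)‖ ≤ ε_x·‖G‖_{prescribedTuples univ (some ∘ (Y₀.2, τ, snd ∘ Y₁))}`. -/
theorem sum_levels_fixed_norm_kernel_sectorPreimage_le {β : ℝ} (hβ : 0 ≤ β) (F : Fin N → FreqMomentum L M → ℂ) (G : HubbardGrassmann L M)
    {k m₁ : ℕ} (Y₀ : SpaceTimeIdx L M × SectorLeg N) (τ : Fin k → SectorLeg N) (Y₁ : Fin m₁ → SpaceTimeIdx L M × SectorLeg N) :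
    ∑ y : Fin k → SpaceTimeIdx L M, ‖kernel ℂ (sectorPreimage β F G) (k + 1 + m₁)
        (Fin.append (Fin.cons Y₀ (fun i => (y i, τ i)) : Fin (k + 1) → SpaceTimeIdx L M × SectorLeg N) Y₁)‖ ≤
      imagTimeWeight β M * hubbardSectorKernelNorm L M β F (prescribedTuples univ (fun i => some
        (Fin.append (Fin.cons Y₀.2 (fun i => τ i) : Fin (k + 1) → SectorLeg N) (fun j => (Y₁ j).2) i))) G := by
  classical
  rw [sum_cons_append_fixed_eq_sum_filter (fun Y => ‖kernel ℂ (sectorPreimage β F G) (k + 1 + m₁) Y‖) Y₀ τ Y₁]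
  refine le_trans (sum_le_sum_of_subset_of_nonneg (fun Y hY => ?_) fun Y _ _ => norm_nonneg _)
    (sum_filter_prescribed_norm_kernel_sectorPreimage_le hβ F G (Fin.castAdd m₁ 0) Y₀ _)
  rw [mem_filter] at hY ⊢
  obtain ⟨-, ⟨h0, hτ⟩, h1⟩ := hY
  refine ⟨mem_univ _, h0, fun i => Fin.addCases (fun i' => ?_) (fun j => ?_) i⟩
  · refine Fin.cases ?_ (fun i'' => ?_) i'
    · intro t ht
      simp only [Fin.append_left, Fin.cons_zero, Option.mem_def, Option.some.injEq] at ht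
      rw [← ht, h0]
    · intro t ht
      simp only [Fin.append_left, Fin.cons_succ, Option.mem_def, Option.some.injEq] at ht
      rw [← ht, hτ i'']
  · intro t ht
    simp only [Fin.append_right, Option.mem_def, Option.some.injEq] at ht
    rw [← ht, h1 j]

end FixedSizes

/-! ## §5 Assembled: the value form between two sector preimages -/

section Assembled

variable {L M N : ℕ} [NeZero L]

/-- **Value form between two sector preimages, in engine currency**: `Ga` at level `m₀ + 1` (its free legs' sectors prescribed, bound `Na` uniform in
them), `Gb` at the TOP level `k + 1 + m₁` (every leg prescribed, bound `Nb` uniform in the prescription):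
`‖kernel ((Δ_×(C′_k)∘⋯∘Δ_×(C′_0))((sectorPreimage β F Ga)⁰·(sectorPreimage β F Gb)¹)) m (Z,s)‖
 ≤ ((k+1+(m₀+1))!(k+1+m₁)!/m!)·α·∏_i(δ_i·4ρ₀)·(ε_x Na)·(ε_x Nb)`. -/
theorem norm_kernel_crossContract_value_sectorPreimage_le {k m m₀ m₁ : ℕ} {β : ℝ} (hβ : 0 ≤ β) (F : Fin N → FreqMomentum L M → ℂ)
    {ρ₀ : ℕ} (hρ₀ : ∀ ω : Fin N, ((univ : Finset (Fin N)).filter fun ω' => ∃ q, F ω q * F ω' q ≠ 0).card ≤ ρ₀)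
    (sym : Fin (k + 1) → FreqMomentum L M × Fin 2 → ℂ) (Ga Gb : HubbardGrassmann L M) (s : Fin m → Fin 2)
    (hm₀ : (univ.filter fun i => s i = 0).card = m₀ + 1) (hm₁ : (univ.filter fun i => s i = 1).card = m₁)
    (Z : Fin m → SpaceTimeIdx L M × SectorLeg N) {α : ℝ} (hα : 0 ≤ α)
    (hrow : ∀ X, ∑ Y, ‖((sectorSubMatrix L M β F).transpose * normalCovariance L M (sym 0) * sectorSubMatrix L M β F) X Y‖ ≤ α)
    (hcol : ∀ Y, ∑ X, ‖((sectorSubMatrix L M β F).transpose * normalCovariance L M (sym 0) * sectorSubMatrix L M β F) X Y‖ ≤ α)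
    (δ : Fin k → ℝ) (hδ : ∀ i, 0 ≤ δ i)
    (hent : ∀ (i : Fin k) X Y,
      ‖((sectorSubMatrix L M β F).transpose * normalCovariance L M (sym i.succ) * sectorSubMatrix L M β F) X Y‖ ≤ δ i)
    {Na Nb : ℝ} (hNb0 : 0 ≤ Nb)
    (hNa : ∀ σ₀ : Fin (m₀ + 1) → SectorLeg N, hubbardSectorKernelNorm L M β F (prescribedTuples univ
      (Fin.append (fun _ : Fin (k + 1) => (none : Option (SectorLeg N))) (fun j => some (σ₀ j)))) Ga ≤ Na)
    (hNb : ∀ Ω : Fin (k + 1 + m₁) → SectorLeg N, hubbardSectorKernelNorm L M β F (prescribedTuples univ (fun i => some (Ω i))) Gb ≤ Nb) :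
    ‖kernel ℂ (((List.ofFn fun i => grassmannLaplacian ℂ (crossCov ℂ
        ((sectorSubMatrix L M β F).transpose * normalCovariance L M (sym i) * sectorSubMatrix L M β F))).reverse).prod
        (dblCopy ℂ 0 (sectorPreimage β F Ga) * dblCopy ℂ 1 (sectorPreimage β F Gb))) m (fun i => (Z i, s i))‖ ≤
      (((k + 1 + (m₀ + 1)).factorial * (k + 1 + m₁).factorial : ℝ) / m.factorial) *
        (α * (∏ i, δ i * ((4 * ρ₀ : ℕ) : ℝ)) * (imagTimeWeight β M * Na) * (imagTimeWeight β M * Nb)) :=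
  norm_kernel_crossContract_value_pullback_le β F hρ₀ sym (sectorPreimage β F Ga) (sectorPreimage β F Gb) s hm₀ hm₁ Z hα hrow hcol δ hδ
    hent (mul_nonneg (imagTimeWeight_nonneg hβ M) hNb0)
    (fun X₀ => (sum_fixed_norm_kernel_sectorPreimage_le hβ F Ga X₀).trans
      (mul_le_mul_of_nonneg_left (hNa _) (imagTimeWeight_nonneg hβ M)))
    fun Y₀ τ Y₁ => (sum_levels_fixed_norm_kernel_sectorPreimage_le hβ F Gb Y₀ τ Y₁).trans
      (mul_le_mul_of_nonneg_left (hNb _) (imagTimeWeight_nonneg hβ M))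

end Assembled

end Summit.HubbardSuperconductivity.HubbardSuperconductivity.Theorems.KLRegimeWick
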